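import Summits.FinalStateConjecture.FinalStateConjecture.Statement
import Mathlib.MeasureTheory.Measure.MeasureSpace

/-!
# Uniform entry of fibres into an open future set; the pigeonhole step of the future-set argument

Solo-blind programme on `FinalStateConjecture`, negative direction (bag-of-gold data), Note B §B13.4
(Theorem B13, "Case B′ by future sets").  Two abstract steps of that proof are recorded here.

* `soloBlind_exists_uniform_entry`: in a product `ℝ × Y` let `A` be OPEN and upward closed in the real
  ("time") variable on each fibre, and suppose every fibre enters `A` (the NO-HORIZON property of the late
  bag cover, hypothesis (L5) of Note B, applied to `A = I⁺(p̃)`).  Then on every compact `K ⊆ Y` the entry is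
  UNIFORM: there is a level `F` with `[F, ∞) × K ⊆ A`.  (Openness makes the entry level upper semicontinuous.)
* `soloBlind_subset_union_of_subset_of_disjoint` / `soloBlind_measure_le_of_cofinal`: if a set `Z` lies in
  `(W ∪ S) ∩ (W' ∪ S')` with `W`, `W'` disjoint (two deck translates of one lift of the flat chart image, (B.4)),
  then `Z ⊆ S ∪ S'`, so `μ Z ≤ μ S + μ S'` for any measure; if the "small sides" `S`, `S'` have total measure
  `< μ Z` this is absurd (`soloBlind_false_of_cofinal`).  In Note B, `Z = {c} × Y₀` is a comoving slab inside
  `I⁺(p̃″) ∩ I⁺(g p̃″)` (uniform entry), `W ∪ S ⊇ I⁺(p̃″)` is true-future containment, and the measure count is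
  leaf volume `e^{3c}·vol_h` against the `o(e^{3c})` small sides of the excision walls.

Pure topology / measure theory; no Lorentzian geometry is used.  Reference for the setting: B. O'Neill,
Semi-Riemannian Geometry, Academic Press 1983, Ch. 14 (chronological futures are open: Lemma 14.3).
-/

noncomputable section

open Set Filter MeasureTheory
open scoped Topology

set_option linter.dupNamespace false

namespace Summit.FinalStateConjecture.FinalStateConjecture.Theorems

section UniformEntry

variable {Y : Type*} [TopologicalSpace Y]

/-- **Uniform entry on compacts.**  If `A ⊆ ℝ × Y` is open and upward closed on each fibre, and every fibre
meets `A`, then for every compact `K ⊆ Y` there is `F` with `(σ, y) ∈ A` for all `y ∈ K` and `σ ≥ F`. -/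
theorem soloBlind_exists_uniform_entry {A : Set (ℝ × Y)} (hA : IsOpen A)
    (hup : ∀ (y : Y) (σ σ' : ℝ), σ ≤ σ' → (σ, y) ∈ A → (σ', y) ∈ A)
    (hmeet : ∀ y : Y, ∃ σ : ℝ, (σ, y) ∈ A) {K : Set Y} (hK : IsCompact K) :
    ∃ F : ℝ, ∀ y ∈ K, ∀ σ : ℝ, F ≤ σ → (σ, y) ∈ A := by
  -- local uniform entry near each point, from openness of `A`
  have key : ∀ y ∈ K, ∃ U ∈ 𝓝[K] y, ∃ F : ℝ, ∀ y' ∈ U, ∀ σ : ℝ, F ≤ σ → (σ, y') ∈ A := by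
    intro y _
    obtain ⟨σ₀, hσ₀⟩ := hmeet y
    have hc : Continuous fun y' : Y => ((σ₀, y') : ℝ × Y) :=
      Continuous.prodMk continuous_const continuous_id
    have hslice : {y' : Y | (σ₀, y') ∈ A} ∈ 𝓝 y :=
      hc.continuousAt.preimage_mem_nhds (hA.mem_nhds hσ₀)
    exact ⟨_, mem_nhdsWithin_of_mem_nhds hslice, σ₀, fun y' hy' σ hσ => hup y' σ₀ σ hσ hy'⟩
  -- compactness
  refine hK.induction_on (p := fun S => ∃ F : ℝ, ∀ y ∈ S, ∀ σ : ℝ, F ≤ σ → (σ, y) ∈ A) ?_ ?_ ?_ key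
  · exact ⟨0, fun y hy => absurd hy (Set.notMem_empty y)⟩
  · rintro S T hST ⟨F, hF⟩
    exact ⟨F, fun y hy => hF y (hST hy)⟩
  · rintro S T ⟨F, hF⟩ ⟨F', hF'⟩
    refine ⟨max F F', fun y hy σ hσ => ?_⟩
    rcases hy with hy | hy
    · exact hF y hy σ ((le_max_left F F').trans hσ)
    · exact hF' y hy σ ((le_max_right F F').trans hσ)

/-- The slab form used in Note B: under the hypotheses of `soloBlind_exists_uniform_entry` for two open
future sets `A`, `A'` (the futures of `p̃″` and of `g • p̃″`), every compact `K` has a level `F` with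
`{c} × K ⊆ A ∩ A'` for all `c ≥ F`. -/
theorem soloBlind_slab_subset_inter {A A' : Set (ℝ × Y)} (hA : IsOpen A) (hA' : IsOpen A')
    (hup : ∀ (y : Y) (σ σ' : ℝ), σ ≤ σ' → (σ, y) ∈ A → (σ', y) ∈ A)
    (hup' : ∀ (y : Y) (σ σ' : ℝ), σ ≤ σ' → (σ, y) ∈ A' → (σ', y) ∈ A')
    (hmeet : ∀ y : Y, ∃ σ : ℝ, (σ, y) ∈ A) (hmeet' : ∀ y : Y, ∃ σ : ℝ, (σ, y) ∈ A')
    {K : Set Y} (hK : IsCompact K) :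
    ∃ F : ℝ, ∀ c : ℝ, F ≤ c → (fun y : Y => ((c, y) : ℝ × Y)) '' K ⊆ A ∩ A' := by
  obtain ⟨F, hF⟩ := soloBlind_exists_uniform_entry hA hup hmeet hK
  obtain ⟨F', hF'⟩ := soloBlind_exists_uniform_entry hA' hup' hmeet' hK
  refine ⟨max F F', fun c hc => ?_⟩
  rintro _ ⟨y, hy, rfl⟩
  exact ⟨hF y hy c ((le_max_left F F').trans hc), hF' y hy c ((le_max_right F F').trans hc)⟩

end UniformEntry

section Pigeonhole

variable {X : Type*}

/-- Set-theoretic core of the endgame: a set contained in `W ∪ S` and in `W' ∪ S'` with `W ∩ W' = ∅` is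
contained in `S ∪ S'`. -/
theorem soloBlind_subset_union_of_subset_of_disjoint {Z W W' S S' : Set X} (hZ : Z ⊆ W ∪ S)
    (hZ' : Z ⊆ W' ∪ S') (hW : Disjoint W W') : Z ⊆ S ∪ S' := by
  intro z hz
  rcases hZ hz with hzW | hzS
  · rcases hZ' hz with hzW' | hzS'
    · exact absurd hzW' (Set.disjoint_left.mp hW hzW)
    · exact Or.inr hzS'
  · exact Or.inl hzS

variable [MeasurableSpace X]

/-- Measure form: under the same hypotheses `μ Z ≤ μ S + μ S'`. -/
theorem soloBlind_measure_le_of_cofinal (μ : Measure X) {Z W W' S S' : Set X} (hZ : Z ⊆ W ∪ S)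
    (hZ' : Z ⊆ W' ∪ S') (hW : Disjoint W W') : μ Z ≤ μ S + μ S' :=
  (measure_mono (soloBlind_subset_union_of_subset_of_disjoint hZ hZ' hW)).trans (measure_union_le S S')

/-- The contradiction of Theorem B13: if moreover the small sides carry total measure `< μ Z` (comoving
volume of the excision walls' small sides `→ 0` against a slab of fixed positive comoving volume), absurd. -/
theorem soloBlind_false_of_cofinal (μ : Measure X) {Z W W' S S' : Set X} (hZ : Z ⊆ W ∪ S)
    (hZ' : Z ⊆ W' ∪ S') (hW : Disjoint W W') (hsmall : μ S + μ S' < μ Z) : False :=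
  absurd (soloBlind_measure_le_of_cofinal μ hZ hZ' hW) (not_le.mpr hsmall)

end Pigeonhole

end Summit.FinalStateConjecture.FinalStateConjecture.Theorems
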